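import Summits.BirchSwinnertonDyer.BirchSwinnertonDyer.Theorems.ManinLocalTwoThreeShimuraFiveFamilyLink
import Literature.NumberTheory.EllipticCurves.SemistabilityDefectSerreFormulaProofs
import Literature.NumberTheory.EllipticCurves.RootNumberAtkinLehnerSemistableProofs
import Literature.NumberTheory.EllipticCurves.RootNumberTableLocalInvarianceProofs
import Literature.NumberTheory.EllipticCurves.SzpiroLocalDataProofs
import Literature.NumberTheory.DiophantineGeometry.LocalReductionIsSemistableAtProofs
import HarnessLib

/-!
# E-es-238 in the kernel: every additive fibre of the Vélu family `veluFive (s⁵)` has `w₅ = −1`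
# (cell bsd-f2-manin, es g44; MEMO-es §67)

`veluFiveFamilyRootNumberLaw_holds : VeluFiveFamilyRootNumberLaw` — the FAMILY COMPUTATION of ROAD δ
(`Summits/…/ManinAdditive/ShimuraFiveFamily.lean`, row E-es-238) is a theorem: for every `s ∈ ℚ` with
`veluFive (s⁵)` elliptic and ADDITIVE at `5`, Rohrlich's local root number at `5` is `−1`.

Proof (the residue-class argument of MEMO-es §66.8 P.S., read through the tree).  Write `s = u/d` in lowest
terms; the scaling `u ↦ d⁻⁵` carries `veluFive (s⁵) = E'_{s⁵,1}` to the INTEGRAL Vélu quotient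
`W₀ = E'_{u⁵,d⁵}` (`kubertTateFive'`, §1).  Its covariant is `c₄ = m⁴ + 228m³n + 494m²n² − 228mn³ + n⁴ ≡ (m − 3n)⁴ (mod 5)`
(`m = u⁵`, `n = d⁵`), so if `5 ∤ c₄` the integral equation is semistable at `5` (`v₅(c₄) = 0`, tree
`isSemistableAt_of_valuation_c₄_eq_one`) — excluded by additivity; hence `u⁵ ≡ 3d⁵`, i.e. `u ≡ 3d (mod 5)` (Fermat),
`5 ∤ d` (coprimality) and `u⁵ ≡ 3⁵d⁵ = 243d⁵ ≡ 18d⁵ (mod 25)`: `m = 18n + 25J` (§3).  In that residue class the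
identities `c₄ = 5⁵·P₄(n,J)`, `c₆ = 5⁹·P₆(n,J)` hold identically (§4, `ring`), and the short model
`W₁ = [0,0,0,−135P₄,−6750P₆]` — `ℚ`-isomorphic to `W₀` by the tree's `smul_eq_of_c₄_c₆` with `e = 5` — has
`Δ(W₁) = 2¹²3¹²5³·(18n+25J)·n·(n² + 5Jn + 5J²)⁵` with the cofactor prime to `5` (`5 ∤ n`) and `5 ∣ c₄(W₁) = 6480P₄`.
So at the place `5`: `W₁` is minimal (`5¹² ∤ Δ`), additive (`5 ∣ c₄, Δ`), `ord₅ Δ_min = 3`, `ord₅ j ≥ 0`; Serre's formula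
(`p ≥ 5`, tree `semistabilityDefectAt_eq_twelve_div_gcd_of_five_le`) gives the semistability defect `e = 12/gcd(12,3) = 4`
(Kodaira III) and Rohrlich's Prop. 2 (iv) (tree `localRootNumber_padic_eq_χ₈'_of_semistabilityDefectAt_eq_four`) gives
`w₅ = χ₈'(5) = (−2/5) = −1` (§2, stated for any `p ≥ 5`).  The local root number and additivity are transported along
the two changes of variables by `localRootNumberAt_variableChange` / `hasAdditiveReductionAt_smul_iff_holds`.

Consequences (§5): E-es-235 `SplitFiveTorsionRootNumberLaw` now follows from the moduli statement E-es-239 alone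
(`splitFiveTorsionRootNumberLaw_of_splitFiveTorsionModuli`), and E-es-227 `ShimuraFiveNoTwentyFive` from E-es-239 and the
two displayed named facts (Carayol; `λ_p = w_p`) by the node's `shimuraFiveNoTwentyFive_of_family veluFiveFamilyRootNumberLaw_holds`.
BSD is not proved here; C2/C3 (`ManinOddAtFour`, its `Γ₁` twin) are untouched and remain OPEN ⟸ CDT.
[cite: Rohrlich1993Compositio, Prop. 2 (iv)] [cite: Serre1972, §5.6] [cite: SilvermanAEC2009, VII.1 Prop. 1.3, VII.5 Prop. 5.1]
[cite: Velu1971, formulae] [cite: Knapp1993, §V.5 (5.31)]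
-/

set_option autoImplicit false
-- lint-debt: the directory name repeats the summit name (sibling precedent `ManinLocalTwoThreeShimuraFiveFamilyLink.lean`)
set_option linter.dupNamespace false

noncomputable section

open WeierstrassCurve Literature.NumberTheory.EllipticCurves IsDedekindDomain Rat.HeightOneSpectrum
open Summit.BirchSwinnertonDyer.Rank1Residual.ManinAdditive Summit.BirchSwinnertonDyer.Rank1Residual.ManinAdditive.EsG43

namespace Summit.BirchSwinnertonDyer.BirchSwinnertonDyer.Theorems.ManinLocalTwoThree.ShimuraFive

/-! ### §1. Covariants of the Vélu quotient `E'_{m,n}` and the scaling to an integral model -/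

section Covariants

variable {R : Type*} [CommRing R] (m n : R)

/-- `c₄(E'_{m,n}) = m⁴ + 228m³n + 494m²n² − 228mn³ + n⁴`. [cite: Velu1971, formulae] -/
theorem kubertTateFive'_c₄ :
    (KubertTateVelu.kubertTateFive' m n).c₄ =
      m ^ 4 + 228 * m ^ 3 * n + 494 * m ^ 2 * n ^ 2 - 228 * m * n ^ 3 + n ^ 4 := by
  simp only [KubertTateVelu.kubertTateFive', c₄, b₂, b₄]
  ring

/-- `c₆(E'_{m,n}) = −m⁶ + 522m⁵n + 10005m⁴n² + 10005m²n⁴ − 522mn⁵ − n⁶`. [cite: Velu1971, formulae] -/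
theorem kubertTateFive'_c₆ :
    (KubertTateVelu.kubertTateFive' m n).c₆ =
      -m ^ 6 + 522 * m ^ 5 * n + 10005 * m ^ 4 * n ^ 2 + 10005 * m ^ 2 * n ^ 4 - 522 * m * n ^ 5 - n ^ 6 := by
  simp only [KubertTateVelu.kubertTateFive', c₆, b₂, b₄, b₆]
  ring

/-- `c₄(E'_{m,n}) = (m − 3n)⁴ + 5·(48m³n + 88m²n² − 24mn³ − 16n⁴)`: the covariant is a fourth power modulo `5`.
[cite: Velu1971, formulae] -/
theorem kubertTateFive'_c₄_eq_pow_four_add :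
    (KubertTateVelu.kubertTateFive' m n).c₄ =
      (m - 3 * n) ^ 4 + 5 * (48 * m ^ 3 * n + 88 * m ^ 2 * n ^ 2 - 24 * m * n ^ 3 - 16 * n ^ 4) := by
  rw [kubertTateFive'_c₄]
  ring

end Covariants

/-- **Scaling the Vélu family to the two-parameter quotient**: `(u = t⁻¹) • veluFive b = E'_{bt,t}` (`aᵢ ↦ tⁱaᵢ`,
Silverman III.1 Table 3.1). [cite: SilvermanAEC2009, III.1 Table 3.1] [cite: Velu1971, formulae] -/
theorem smul_veluFive (b t : ℚ) (ht : t ≠ 0) :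
    (⟨(Units.mk0 t ht)⁻¹, 0, 0, 0⟩ : VariableChange ℚ) • veluFive b = KubertTateVelu.kubertTateFive' (b * t) t := by
  rw [veluFive_eq_kubertTateFive']
  ext
  · simp only [variableChange_a₁, KubertTateVelu.kubertTateFive', inv_inv, Units.val_mk0]; ring
  · simp only [variableChange_a₂, KubertTateVelu.kubertTateFive', inv_inv, Units.val_mk0]; ring
  · simp only [variableChange_a₃, KubertTateVelu.kubertTateFive', inv_inv, Units.val_mk0]; ring
  · simp only [variableChange_a₄, KubertTateVelu.kubertTateFive', inv_inv, Units.val_mk0]; ring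
  · simp only [variableChange_a₆, KubertTateVelu.kubertTateFive', inv_inv, Units.val_mk0]; ring

/-- The integral quotient `E'_{m,n}/ℤ` base-changes to the rational one. [cite: Velu1971, formulae] -/
theorem baseChange_kubertTateFive'_int (m n : ℤ) :
    (KubertTateVelu.kubertTateFive' m n).baseChange ℚ = KubertTateVelu.kubertTateFive' (m : ℚ) (n : ℚ) := by
  rw [baseChange, KubertTateVelu.map_kubertTateFive', eq_intCast, eq_intCast]

/-! ### §2. Kodaira type III at `p ≥ 5`: `ord_p Δ = 3` and `p ∣ c₄` give `w_p = χ₈'(p) = (−2/p)` -/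

/-- **`w_p = (−2/p)` for an integral equation with `ord_p Δ = 3`, `p ∣ c₄`, `p ≥ 5`.**  Such an equation is minimal at
`p` (`p¹² ∤ Δ`) and additive there (`p ∣ c₄`, `p ∣ Δ`), with `ord_p Δ_min = 3` and `ord_p j = 3 ord_p c₄ − 3 ≥ 0`
(potentially good); Serre's formula for `p ≥ 5` gives the semistability defect `e = 12 / gcd(12, 3) = 4` (Kodaira III) and
Rohrlich's Prop. 2 (iv) gives `W(E/ℚ_p) = (−2/p) = χ₈'(p)`.  [cite: Rohrlich1993Compositio, Prop. 2 (iv)]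
[cite: Serre1972, §5.6] [cite: SilvermanAEC2009, VII.1 Prop. 1.3 and Remark 1.1] -/
theorem localRootNumberAt_baseChange_int_eq_χ₈'_of_Δ_eq {p : ℕ} [Fact p.Prime] (hp5 : 5 ≤ p)
    (W₁ : WeierstrassCurve ℤ) [(W₁.baseChange ℚ).IsElliptic] {D : ℤ}
    (hΔ : W₁.Δ = (p : ℤ) ^ 3 * D) (hD : ¬ (p : ℤ) ∣ D) (hc : (p : ℤ) ∣ W₁.c₄) :
    (W₁.baseChange ℚ).localRootNumberAt ((primesEquiv (R := ℤ)).symm ⟨p, Fact.out⟩) = ZMod.χ₈' p := by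
  have hp : p.Prime := Fact.out
  have hv : ((primesEquiv (R := ℤ) ((primesEquiv (R := ℤ)).symm ⟨p, Fact.out⟩) : Nat.Primes) : ℕ) = p :=
    congrArg Subtype.val ((primesEquiv (R := ℤ)).apply_symm_apply ⟨p, Fact.out⟩)
  have hgen : natGenerator ((primesEquiv (R := ℤ)).symm ⟨p, Fact.out⟩) = p := hv
  have hp0 : (p : ℤ) ≠ 0 := by exact_mod_cast hp.ne_zero
  have hΔ0 : W₁.Δ ≠ 0 := Δ_ne_zero_of_isElliptic_baseChange_int W₁
  have h3 : (p : ℤ) ^ 3 ∣ W₁.Δ := ⟨D, hΔ⟩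
  have h4 : ¬ (p : ℤ) ^ 4 ∣ W₁.Δ := by
    rw [hΔ, pow_succ]
    exact fun h ↦ hD ((mul_dvd_mul_iff_left (pow_ne_zero 3 hp0)).mp h)
  have h12 : ¬ (p : ℤ) ^ 12 ∣ W₁.Δ := fun h ↦ h4 ((pow_dvd_pow (p : ℤ) (by norm_num)).trans h)
  have h1 : (p : ℤ) ∣ W₁.Δ := (dvd_pow_self (p : ℤ) three_ne_zero).trans h3
  -- minimal and additive at `p`
  have hmin : (W₁.baseChange ℚ).IsMinimalAt ((primesEquiv (R := ℤ)).symm ⟨p, Fact.out⟩) :=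
    isMinimalAt_baseChange_int_of_not_pow_dvd_Δ (by rw [hgen]; exact h12)
  have hadd : (W₁.baseChange ℚ).HasAdditiveReductionAt ((primesEquiv (R := ℤ)).symm ⟨p, Fact.out⟩) := by
    rw [hasAdditiveReductionAt_iff_of_isMinimalAt hmin, baseChange_int_Δ, baseChange_int_c₄,
      Literature.NumberTheory.EllipticCurves.Rat.valuation_intCast_lt_one_iff,
      Literature.NumberTheory.EllipticCurves.Rat.valuation_intCast_lt_one_iff, hgen]
    exact ⟨h1, hc⟩
  -- `ord_p Δ_min = 3`
  have hord : (W₁.baseChange ℚ).ordMinimalDiscriminant ((primesEquiv (R := ℤ)).symm ⟨p, Fact.out⟩) = 3 := by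
    have hval := valuation_Δ_eq_of_isMinimalAt_holds ((primesEquiv (R := ℤ)).symm ⟨p, Fact.out⟩)
      (W₁.baseChange ℚ) hmin
    rw [baseChange_int_Δ] at hval
    have key : ∀ k : ℕ, (natGenerator ((primesEquiv (R := ℤ)).symm ⟨p, Fact.out⟩) : ℤ) ^ k ∣ W₁.Δ ↔
        k ≤ (W₁.baseChange ℚ).ordMinimalDiscriminant ((primesEquiv (R := ℤ)).symm ⟨p, Fact.out⟩) := by
      intro k
      rw [← Literature.NumberTheory.EllipticCurves.Rat.valuation_intCast_le_exp_iff _ W₁.Δ k, hval,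
        WithZero.exp_le_exp, neg_le_neg_iff, Nat.cast_le]
    have h3' := (key 3).mp (by rw [hgen]; exact h3)
    have h4' : ¬ 4 ≤ (W₁.baseChange ℚ).ordMinimalDiscriminant ((primesEquiv (R := ℤ)).symm ⟨p, Fact.out⟩) :=
      fun h ↦ h4 (by have := (key 4).mpr h; rwa [hgen] at this)
    omega
  -- `ord_p j ≥ 0`
  have hj : 0 ≤ padicValRat p (W₁.baseChange ℚ).j := by
    have hjW : (W₁.baseChange ℚ).j = ((W₁.c₄ : ℚ)) ^ 3 / (W₁.Δ : ℚ) := by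
      rw [WeierstrassCurve.j, Units.val_inv_eq_inv_val, coe_Δ', baseChange_int_c₄, baseChange_int_Δ, div_eq_inv_mul]
    rw [hjW]
    by_cases hc0 : W₁.c₄ = 0
    · rw [hc0]; simp
    have hvc : 1 ≤ padicValInt p W₁.c₄ :=
      ((padicValInt_dvd_iff 1 W₁.c₄).mp (by rwa [pow_one])).resolve_left hc0
    have hvΔ : padicValInt p W₁.Δ ≤ 3 := by
      by_contra hlt
      exact h4 ((padicValInt_dvd_iff 4 W₁.Δ).mpr (Or.inr (by omega)))
    have hc0' : ((W₁.c₄ : ℚ)) ^ 3 ≠ 0 := pow_ne_zero 3 (by exact_mod_cast hc0)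
    have hΔ0' : (W₁.Δ : ℚ) ≠ 0 := by exact_mod_cast hΔ0
    rw [padicValRat.div hc0' hΔ0', padicValRat.pow, padicValRat.of_int, padicValRat.of_int]
    push_cast
    omega
  -- Serre: `e = 12 / gcd(12, 3) = 4`; Rohrlich: `w_p = χ₈'(p)`
  have he : (W₁.baseChange ℚ).semistabilityDefectAt p = 4 := by
    rw [(W₁.baseChange ℚ).semistabilityDefectAt_eq_twelve_div_gcd_of_five_le
      ((primesEquiv (R := ℤ)).symm ⟨p, Fact.out⟩) hv hp5 hj, hord]
    decide
  have hadd' := ((W₁.baseChange ℚ).hasAdditiveReduction_padic_iff_hasAdditiveReductionAt_int ⟨p, Fact.out⟩).mpr hadd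
  rw [(W₁.baseChange ℚ).localRootNumberAt_primesEquiv_symm_eq (R := ℤ) ⟨p, Fact.out⟩]
  exact (W₁.baseChange ℚ).localRootNumber_padic_eq_χ₈'_of_semistabilityDefectAt_eq_four hp5 hadd' he

/-- **At `p = 5`**: an integral equation with `ord₅ Δ = 3` and `5 ∣ c₄` has `w₅ = χ₈'(5) = (−2/5) = −1`.
[cite: Rohrlich1993Compositio, Prop. 2 (iv)] [cite: Serre1972, §5.6] -/
theorem localRootNumberAt_five_baseChange_int_eq_neg_one (W₁ : WeierstrassCurve ℤ) [(W₁.baseChange ℚ).IsElliptic]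
    {D : ℤ} (hΔ : W₁.Δ = 5 ^ 3 * D) (hD : ¬ (5 : ℤ) ∣ D) (hc : (5 : ℤ) ∣ W₁.c₄) :
    (W₁.baseChange ℚ).localRootNumberAt ((primesEquiv (R := ℤ)).symm ⟨5, by norm_num⟩) = -1 := by
  haveI : Fact (Nat.Prime 5) := ⟨by norm_num⟩
  have h := localRootNumberAt_baseChange_int_eq_χ₈'_of_Δ_eq (p := 5) le_rfl W₁ (D := D)
    (by exact_mod_cast hΔ) (by exact_mod_cast hD) (by exact_mod_cast hc)
  rw [ZMod.χ₈'_nat_eq_if_mod_eight] at h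
  norm_num at h
  exact h

/-! ### §3. The residue classes: `5 ∣ c₄(E'_{u⁵,d⁵})` forces `u ≡ 3d (mod 5)` -/

/-- If `5 ∣ c₄(E'_{u⁵,d⁵})` then `u ≡ 3d (mod 5)`: `c₄ ≡ (u⁵ − 3d⁵)⁴ ≡ (u − 3d)⁴ (mod 5)` by Fermat.
[cite: Velu1971, formulae] -/
theorem five_dvd_sub_of_five_dvd_c₄ {u d : ℤ}
    (h : (5 : ℤ) ∣ (KubertTateVelu.kubertTateFive' (u ^ 5) (d ^ 5)).c₄) : (5 : ℤ) ∣ u - 3 * d := by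
  haveI : Fact (Nat.Prime 5) := ⟨by norm_num⟩
  rw [kubertTateFive'_c₄_eq_pow_four_add] at h
  have h' : (5 : ℤ) ∣ (u ^ 5 - 3 * d ^ 5) ^ 4 := (dvd_add_left (dvd_mul_right 5 _)).mp h
  have hZ : (((u ^ 5 - 3 * d ^ 5) ^ 4 : ℤ) : ZMod 5) = 0 :=
    (ZMod.intCast_zmod_eq_zero_iff_dvd _ 5).mpr (by exact_mod_cast h')
  push_cast at hZ
  rw [ZMod.pow_card, ZMod.pow_card] at hZ
  have h0 : (u : ZMod 5) - 3 * (d : ZMod 5) = 0 := (pow_eq_zero_iff (by norm_num)).mp hZ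
  have h1 : (((u - 3 * d : ℤ)) : ZMod 5) = 0 := by push_cast; exact h0
  exact_mod_cast (ZMod.intCast_zmod_eq_zero_iff_dvd _ 5).mp h1

/-! ### §4. The additive residue class `m ≡ 18n (mod 25)`, `5 ∤ n`: Kodaira III at `5`, `w₅ = −1` -/

/-- **`w₅(E'_{m,n}) = −1` for `m = 18n + 25J`, `5 ∤ n`.**  In this class `c₄ = 5⁵P₄`, `c₆ = 5⁹P₆` identically; the short
model `[0,0,0,−135P₄,−6750P₆]` (isomorphic over `ℚ`, `e = 5` in `smul_eq_of_c₄_c₆`) has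
`Δ = 2¹²3¹²5³(18n+25J)n(n²+5Jn+5J²)⁵`, cofactor prime to `5`, and `5 ∣ c₄ = 6480P₄`: §2 applies.
[cite: Rohrlich1993Compositio, Prop. 2 (iv)] [cite: Velu1971, formulae] [cite: SilvermanAEC2009, VII.1 Prop. 1.3] -/
theorem localRootNumberAt_five_kubertTateFive'_eq_neg_one_of_eq (m n J : ℤ) (hm : m = 18 * n + 25 * J)
    (hn : ¬ (5 : ℤ) ∣ n) [((KubertTateVelu.kubertTateFive' m n).baseChange ℚ).IsElliptic] :
    ((KubertTateVelu.kubertTateFive' m n).baseChange ℚ).localRootNumberAt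
      ((primesEquiv (R := ℤ)).symm ⟨5, by norm_num⟩) = -1 := by
  subst hm
  obtain ⟨P₄, hP₄⟩ : ∃ P : ℤ,
      P = 125 * J ^ 4 + 1500 * J ^ 3 * n + 2950 * J ^ 2 * n ^ 2 + 2100 * J * n ^ 3 + 509 * n ^ 4 := ⟨_, rfl⟩
  obtain ⟨P₆, hP₆⟩ : ∃ P : ℤ, P = -125 * J ^ 6 + 2070 * J ^ 5 * n + 10425 * J ^ 4 * n ^ 2 + 18360 * J ^ 3 * n ^ 3
      + 15465 * J ^ 2 * n ^ 4 + 6354 * J * n ^ 5 + 1027 * n ^ 6 := ⟨_, rfl⟩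
  have hc4 : (KubertTateVelu.kubertTateFive' (18 * n + 25 * J) n).c₄ = 5 ^ 5 * P₄ := by
    rw [kubertTateFive'_c₄, hP₄]; ring
  have hc6 : (KubertTateVelu.kubertTateFive' (18 * n + 25 * J) n).c₆ = 5 ^ 9 * P₆ := by
    rw [kubertTateFive'_c₆, hP₆]; ring
  have h4 : (5 : ℤ) ^ 4 * (-135 * P₄) = -27 * (KubertTateVelu.kubertTateFive' (18 * n + 25 * J) n).c₄ := by
    rw [hc4]; ring
  have h6 : (5 : ℤ) ^ 6 * (-6750 * P₆) = -54 * (KubertTateVelu.kubertTateFive' (18 * n + 25 * J) n).c₆ := by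
    rw [hc6]; ring
  have hCW := smul_eq_of_c₄_c₆ (KubertTateVelu.kubertTateFive' (18 * n + 25 * J) n) (e := 5) (by norm_num) h4 h6
  haveI hE₁ : ((⟨0, 0, 0, -135 * P₄, -6750 * P₆⟩ : WeierstrassCurve ℤ).baseChange ℚ).IsElliptic := by
    rw [← hCW]; infer_instance
  have hΔ₁ : (⟨0, 0, 0, -135 * P₄, -6750 * P₆⟩ : WeierstrassCurve ℤ).Δ =
      5 ^ 3 * (2 ^ 12 * 3 ^ 12 * ((18 * n + 25 * J) * n * (n ^ 2 + 5 * J * n + 5 * J ^ 2) ^ 5)) := by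
    simp only [Δ, b₂, b₄, b₆, b₈, hP₄, hP₆]; ring
  have hc₁ : (5 : ℤ) ∣ (⟨0, 0, 0, -135 * P₄, -6750 * P₆⟩ : WeierstrassCurve ℤ).c₄ :=
    ⟨1296 * P₄, by simp only [c₄, b₂, b₄]; ring⟩
  have hD : ¬ (5 : ℤ) ∣ 2 ^ 12 * 3 ^ 12 * ((18 * n + 25 * J) * n * (n ^ 2 + 5 * J * n + 5 * J ^ 2) ^ 5) := by
    have hp5 : Prime (5 : ℤ) := Int.prime_iff_natAbs_prime.mpr (by norm_num)
    have hm5 : ¬ (5 : ℤ) ∣ 18 * n + 25 * J := by omega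
    have hR : ¬ (5 : ℤ) ∣ n ^ 2 + 5 * J * n + 5 * J ^ 2 := by
      intro h
      have h2 : (5 : ℤ) ∣ n ^ 2 :=
        (dvd_add_left (dvd_mul_of_dvd_left (dvd_mul_right 5 J) n)).mp
          ((dvd_add_left (dvd_mul_right 5 (J ^ 2))).mp h)
      exact hn (hp5.dvd_of_dvd_pow h2)
    intro h
    rcases hp5.dvd_mul.mp h with h | h
    · norm_num at h
    rcases hp5.dvd_mul.mp h with h | h
    · rcases hp5.dvd_mul.mp h with h | h
      · exact hm5 h
      · exact hn h
    · exact hR (hp5.dvd_of_dvd_pow h)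
  have key := localRootNumberAt_five_baseChange_int_eq_neg_one _ hΔ₁ hD hc₁
  rw [← hCW, localRootNumberAt_variableChange] at key
  exact key

/-- **`w₅(E'_{u⁵,d⁵}) = −1` at every additive fibre, `(u, d) = 1`.**  Additive at `5` ⟹ `5 ∣ c₄` (else `v₅(c₄) = 0` and the
integral equation is semistable at `5`) ⟹ `u ≡ 3d (mod 5)` (§3) ⟹ `5 ∤ d` and `u⁵ ≡ 243d⁵ ≡ 18d⁵ (mod 25)`; §4 applies.
[cite: Rohrlich1993Compositio, Prop. 2 (iv)] [cite: SilvermanAEC2009, VII.5 Prop. 5.1] [cite: Velu1971, formulae] -/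
theorem localRootNumberAt_five_kubertTateFive'_pow_eq_neg_one {u d : ℤ} (hcop : IsCoprime u d)
    [((KubertTateVelu.kubertTateFive' (u ^ 5) (d ^ 5)).baseChange ℚ).IsElliptic]
    (hadd : ((KubertTateVelu.kubertTateFive' (u ^ 5) (d ^ 5)).baseChange ℚ).HasAdditiveReductionAt
      ((primesEquiv (R := ℤ)).symm ⟨5, by norm_num⟩)) :
    ((KubertTateVelu.kubertTateFive' (u ^ 5) (d ^ 5)).baseChange ℚ).localRootNumberAt
      ((primesEquiv (R := ℤ)).symm ⟨5, by norm_num⟩) = -1 := by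
  have hgen : natGenerator ((primesEquiv (R := ℤ)).symm ⟨5, by norm_num⟩) = 5 :=
    Literature.NumberTheory.EllipticCurves.Rat.natGenerator_primesEquiv_symm ⟨5, by norm_num⟩
  -- additive ⟹ `5 ∣ c₄`
  have h5c : (5 : ℤ) ∣ (KubertTateVelu.kubertTateFive' (u ^ 5) (d ^ 5)).c₄ := by
    by_contra h
    have hns := (((KubertTateVelu.kubertTateFive' (u ^ 5) (d ^ 5)).baseChange ℚ).not_isSemistableAt_iff_hasAdditiveReductionAt
      ((primesEquiv (R := ℤ)).symm ⟨5, by norm_num⟩)).mpr hadd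
    exact hns (isSemistableAt_of_valuation_c₄_eq_one (isIntegralAt_baseChange_int _ _)
      (by rw [baseChange_int_c₄, Literature.NumberTheory.EllipticCurves.Rat.valuation_intCast_eq_one_iff, hgen]; exact h))
  -- `u ≡ 3d (mod 5)`, `5 ∤ d`, `u⁵ = 18d⁵ + 25J`
  obtain ⟨k, hk⟩ := five_dvd_sub_of_five_dvd_c₄ h5c
  have hu : u = 3 * d + 5 * k := by omega
  have h5d : ¬ (5 : ℤ) ∣ d := by
    intro h5d
    have h5u : (5 : ℤ) ∣ u := by
      rw [hu]; exact dvd_add (dvd_mul_of_dvd_right h5d 3) (dvd_mul_right 5 k)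
    have hU := hcop.isUnit_of_dvd' h5u h5d
    rw [Int.isUnit_iff] at hU
    omega
  have h5d5 : ¬ (5 : ℤ) ∣ d ^ 5 := fun h ↦
    h5d ((Int.prime_iff_natAbs_prime.mpr (by norm_num) : Prime (5 : ℤ)).dvd_of_dvd_pow h)
  obtain ⟨J, hJ⟩ : ∃ J : ℤ, u ^ 5 = 18 * d ^ 5 + 25 * J :=
    ⟨9 * d ^ 5 + 81 * d ^ 4 * k + 270 * d ^ 3 * k ^ 2 + 450 * d ^ 2 * k ^ 3 + 375 * d * k ^ 4 + 125 * k ^ 5, by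
      rw [hu]; ring⟩
  exact localRootNumberAt_five_kubertTateFive'_eq_neg_one_of_eq (u ^ 5) (d ^ 5) J hJ h5d5

/-! ### §5. E-es-238 and its consequences -/

/-- **E-es-238 `VeluFiveFamilyRootNumberLaw` HOLDS**: for every `s ∈ ℚ` with `veluFive (s⁵)` elliptic and additive at `5`,
Rohrlich's local root number at `5` is `−1` (Kodaira III, `e = 4`, `(−2/5) = −1`).  Write `s = u/d` in lowest terms and
scale by `d⁵` to the integral quotient `E'_{u⁵,d⁵}`; root number and additivity are invariants of the curve.
[cite: Rohrlich1993Compositio, Prop. 2 (iv)] [cite: Rohrlich1994CRM, §19] [cite: SilvermanAEC2009, VII.5 Prop. 5.1(c)]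
[cite: Velu1971, formulae] -/
theorem veluFiveFamilyRootNumberLaw_holds : VeluFiveFamilyRootNumberLaw := by
  intro s hE hadd
  obtain ⟨u, hu⟩ : ∃ u : ℤ, u = s.num := ⟨_, rfl⟩
  obtain ⟨d, hd⟩ : ∃ d : ℤ, d = s.den := ⟨_, rfl⟩
  have hd0 : (d : ℚ) ≠ 0 := by rw [hd]; exact_mod_cast s.den_nz
  have hs' : s = (u : ℚ) / (d : ℚ) := by rw [hu, hd, Int.cast_natCast, Rat.num_div_den]
  have hcop : IsCoprime u d := by rw [hu, hd]; exact Rat.isCoprime_num_den s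
  have hCW : (⟨(Units.mk0 ((d : ℚ) ^ 5) (pow_ne_zero 5 hd0))⁻¹, 0, 0, 0⟩ : VariableChange ℚ) • veluFive (s ^ 5) =
      (KubertTateVelu.kubertTateFive' (u ^ 5) (d ^ 5)).baseChange ℚ := by
    rw [smul_veluFive, baseChange_kubertTateFive'_int, Int.cast_pow, Int.cast_pow, hs', div_pow,
      div_mul_cancel₀ _ (pow_ne_zero 5 hd0)]
  haveI : ((KubertTateVelu.kubertTateFive' (u ^ 5) (d ^ 5)).baseChange ℚ).IsElliptic := by
    rw [← hCW]; infer_instance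
  have hadd' : ((KubertTateVelu.kubertTateFive' (u ^ 5) (d ^ 5)).baseChange ℚ).HasAdditiveReductionAt
      ((primesEquiv (R := ℤ)).symm ⟨5, by norm_num⟩) := by
    rw [← hCW]
    exact (hasAdditiveReductionAt_smul_iff_holds _ (veluFive (s ^ 5)) _).mpr hadd
  have h := localRootNumberAt_five_kubertTateFive'_pow_eq_neg_one hcop hadd'
  rw [← hCW, localRootNumberAt_variableChange] at h
  exact h

/-- **E-es-235 ⟸ E-es-239.**  With the family computation a theorem, the LOCAL LAW L5 (`SplitFiveTorsionRootNumberLaw`: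
rational `5`-torsion + `W[5]` fixed by `Gal(ℚ̄/ℚ(μ₅))` + additive at `5` ⟹ `w₅ = −1`) follows from the moduli statement
`SplitFiveTorsionModuli` alone. [cite: Rohrlich1993Compositio, Prop. 2 (iv)] [cite: Velu1971, formulae] -/
theorem splitFiveTorsionRootNumberLaw_of_splitFiveTorsionModuli (h : SplitFiveTorsionModuli) :
    SplitFiveTorsionRootNumberLaw :=
  splitFiveTorsionRootNumberLaw_of_family veluFiveFamilyRootNumberLaw_holds h

end Summit.BirchSwinnertonDyer.BirchSwinnertonDyer.Theorems.ManinLocalTwoThree.ShimuraFive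

end
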